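import Summits.Ventures.Crystal3D.Bulk.LocalTwelveOfHales
import Literature.Geometry.DiscreteGeometry.KissingTwelveLocal
import HarnessLib

/-!
# The twelve-neighbour gap: the one remaining input of the bulk-crystallization reduction

HONEST FRAMING. Part of the venture `Summits/Ventures/Crystal3D` (cell `pub-crystal3d`, phase 2,
PLAN R41: "the one remaining target = GAP"). After `Bulk/LocalTwelve.lean` (the statement
`BulkCrystallization3D` and its reduction to `L12Local`) and `Bulk/LocalTwelveOfHales.lean`
(`L12Local` from `flyspeck_L12` + the classification `Hales2012_kissingConfigCongruent`, the latter
PROVED computationally in the tree), the only use of the named fact `flyspeck_L12` (Hales 2012,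
Lemma 1, HOL-Light-verified, not Lean) is the LOCAL TWELVE-NEIGHBOUR GAP: a ball touched by twelve
others has no further centre closer than `2h₀ = 2.52` radii, i.e. `h₀ = 1.26` diameters. This
file ISOLATES that statement as a Prop of the venture's vocabulary, `TwelveNeighbourGap ρ`
(parameter `ρ` = the gap in contact-distance-`1` units), so that the cell's census / certificate (route G1:
certify the gap at `ρ = 1.26`; route G2: Böröczky–Szabó's printed Flyspeck-free
`ρ = 2.51838585 / 2` with a re-run classification) enters VERBATIM, and proves:

* `twelveNeighbourGap_of_L12 : flyspeck_L12 → TwelveNeighbourGap hales_h0` (`hales_h0 = 1.26`;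
  Hales 2012 Lemma 2 read locally — the tree theorem `hales2012_separation_local_of_L12` of
  `Literature/Geometry/DiscreteGeometry/KissingTwelveLocal.lean`, transported to finite labelled
  packings of unit-diameter balls);
* `isKissingConfig_contactShell_of_gap` : under `TwelveNeighbourGap hales_h0`, the contact shell of
  a twelve-coordinated ball all of whose neighbours are twelve-coordinated is a kissing
  configuration (`∈ 𝒱`, Hales's Definition 1);
* `l12Local_of_gap : TwelveNeighbourGap hales_h0 → Hales2012_kissingConfigCongruent → L12Local`
  and `bulkCrystallization3D_of_gap : TwelveNeighbourGap hales_h0 →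
  Hales2012_kissingConfigCongruent → BulkCrystallization3D 1296` — so that, with the tree's
  computational `Hales2012_kissingConfigCongruent_holds`, BULK CRYSTALLIZATION IS CONDITIONAL ON
  `TwelveNeighbourGap 1.26` ALONE (corollary in the computational companion file);
* `TwelveNeighbourGap.anti` (a smaller gap is a weaker statement).

NOTHING here is a new mathematical claim: `TwelveNeighbourGap 1.26` is Hales's Lemma 2 /
Bezdek–Reid 2013 Theorem 5 (radius-`1` form: `2.52`) in the venture's normalisation, PROVED below
from `flyspeck_L12`; whether it admits an ELEMENTARY certified proof (a fourteen-ball extremal problem of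
Tammes-13 type; Böröczky–Szabó 2015, Theorem 3, prove `2.51838585 < 2.52` Flyspeck-free from
Musin–Tarasov's thirteen-sphere theorem — tree named fact `BoroczkySzabo2015_thm3`) is the
cell's open question, not asserted.

## Sources (as printed)

* T. C. Hales, arXiv:1209.6043 (2012), Lemma 2 and its proof (local use of Lemma 1 = `L12`).
* K. Bezdek, S. Reid, J. Geom. 104 (2013), Theorem 5 ("Let `B_1, …, B_14` be 14 different members
  of a packing of unit balls … each of `B_2, …, B_13` touches `B_1`. Then the distance between
  the centers of `B_1` and `B_14` is at least `2.52`"; tree: `hales_twelveNeighbourGap_of_L12`).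
* K. Böröczky, L. Szabó, Acta Math. Hungar. 146 (2015), Theorem 3 (`2.51838585…`).
-/

noncomputable section

open scoped BigOperators
open Finset

namespace Summit.Ventures.Crystal3D

open Literature.Geometry.DiscreteGeometry

variable {N : ℕ} {x : Fin N → EuclideanSpace ℝ (Fin 3)}

/-! ## The statement -/

/-- **The twelve-neighbour gap with constant `ρ`** (contact-distance-`1` units): in every finite
packing of unit-diameter balls in `ℝ³`, if ball `i` has twelve contacts then every other ball `j`
either touches `i` (`dist = 1`) or has its centre at distance `≥ ρ` from the centre of `i`.
KNOWN for `ρ = h₀ = 1.26` from Hales's Lemma 1 (`twelveNeighbourGap_of_L12`; radius-`1` form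
`2.52`: Hales 2012 Lemma 2, Bezdek–Reid 2013 Theorem 5) and, Flyspeck-free in print, for
`ρ = 2.51838585 / 2` (Böröczky–Szabó 2015, Theorem 3). The cell's census target (PLAN R41, G1)
is an elementary certificate at `ρ = 1.26`; this definition is that target's formal referent, not a
claim. -/
def TwelveNeighbourGap (ρ : ℝ) : Prop :=
  ∀ (N : ℕ) (x : Fin N → EuclideanSpace ℝ (Fin 3)), IsUnitPacking x → ∀ i j : Fin N,
    coordination x i = 12 → j ≠ i → dist (x i) (x j) = 1 ∨ ρ ≤ dist (x i) (x j)

/-- A smaller gap constant is a weaker statement. -/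
theorem TwelveNeighbourGap.anti {ρ ρ' : ℝ} (h : ρ' ≤ ρ) (hρ : TwelveNeighbourGap ρ) :
    TwelveNeighbourGap ρ' := fun N x hx i j hi hj =>
  (hρ N x hx i j hi hj).imp_right fun h' => h.trans h'

/-! ## The gap from `flyspeck_L12` (Hales 2012, Lemma 2, read locally) -/

/-- **`flyspeck_L12` gives the twelve-neighbour gap `h₀ = 1.26`**: Hales's Lemma 2 at the one
twelve-coordinated centre (tree: `hales2012_separation_local_of_L12`), applied to the doubled
packing `{2 xⱼ}` and scaled back. -/
theorem twelveNeighbourGap_of_L12 (hL12 : flyspeck_L12) : TwelveNeighbourGap hales_h0 := by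
  intro N x hx i j hi hj
  have hV := isUnitBallPacking_range_two_smul hx
  have h12 :
      (kissingShell (Set.range fun k => (2 : ℝ) • x k) ((2 : ℝ) • x i)).ncard = 12 := by
    rw [ncard_kissingShell_range_two_smul hx, hi]
  rcases hales2012_separation_local_of_L12 hL12 hV ⟨i, rfl⟩ h12 ((2 : ℝ) • x j) ⟨j, rfl⟩
    with h | h | h
  · exact absurd (hx.injective (smul_right_injective _ (two_ne_zero (α := ℝ)) h)).symm hj
  · left
    rw [dist_two_smul] at h
    linarith
  · right
    rw [dist_two_smul] at h
    linarith

/-! ## From the gap to `L12Local` and to bulk crystallization -/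

/-- **Under the gap, saturated shells of saturated balls are kissing configurations**: if
`TwelveNeighbourGap h₀` holds, `x` is a packing, ball `i` has twelve contacts and so does each of
its contact neighbours, then `contactShell x i ∈ 𝒱` (`IsKissingConfig`: twelve points of
`S²(2)` pairwise at distance `2` or `≥ 2h₀`) — the gap AT EACH NEIGHBOUR separates the shell
points. -/
theorem isKissingConfig_contactShell_of_gap (hgap : TwelveNeighbourGap hales_h0)
    (hx : IsUnitPacking x) {i : Fin N} (hi : coordination x i = 12)
    (hnb : ∀ j ∈ contactNeighbors x i, coordination x j = 12) :
    IsKissingConfig (contactShell x i) := by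
  refine ⟨by rw [ncard_contactShell hx, hi], fun v hv => norm_eq_two_of_mem_contactShell hv,
    fun v hv w hw => ?_⟩
  obtain ⟨j, hj, rfl⟩ := mem_contactShell.1 hv
  obtain ⟨k, hk, rfl⟩ := mem_contactShell.1 hw
  by_cases hjk : k = j
  · exact Or.inl (by rw [hjk])
  right
  have hd :
      dist ((2 : ℝ) • (x j - x i)) ((2 : ℝ) • (x k - x i)) = 2 * dist (x j) (x k) := by
    rw [dist_two_smul, dist_eq_norm, dist_eq_norm, sub_sub_sub_cancel_right]
  rw [hd]
  rcases hgap N x hx j k (hnb j hj) hjk with h | h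
  · exact Or.inl (by rw [h]; norm_num)
  · exact Or.inr (by linarith)

/-- **`L12(1)` from the gap and the classification**: `TwelveNeighbourGap h₀` and
`Hales2012_kissingConfigCongruent` imply `L12Local`. -/
theorem l12Local_of_gap (hgap : TwelveNeighbourGap hales_h0)
    (hcl : Hales2012_kissingConfigCongruent) : L12Local :=
  fun _N _x hx _i hi hnb => hcl _ (isKissingConfig_contactShell_of_gap hgap hx hi hnb)

/-- **Bulk crystallization from the gap and the classification** (standard axioms; with the
tree's computational `Hales2012_kissingConfigCongruent_holds` the second hypothesis disappears —
see the computational companion file). -/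
theorem bulkCrystallization3D_of_gap (hgap : TwelveNeighbourGap hales_h0)
    (hcl : Hales2012_kissingConfigCongruent) : BulkCrystallization3D 1296 :=
  bulkCrystallization3D_of_L12Local (l12Local_of_gap hgap hcl)

end Summit.Ventures.Crystal3D

end
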